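import Summits.Schanuel.Schanuel.Theorems.DiophantineDichotomyApproximationPropertyResiduals
import Summits.Schanuel.Schanuel.Theorems.DiophantineDichotomyApproximationPropertyBoxAvoiding
import Summits.Schanuel.Schanuel.Theorems.DiophantineDichotomyApproximationPropertyCycleAPIAt3DataThin
import Summits.Schanuel.Schanuel.Theorems.DiophantineDichotomyApproximationPropertyFourthFormOrEnveloped
import Literature.RingTheory.GradedAlgebra.IsolatedComponentRegularityProofs
import HarnessLib

/-!
# `PointAPAbsAt 3` and the `t = 3` slice of the crux, CONDITIONALLY on ONE statement: the far ENVELOPED satellite kernel (crux `ApproximationProperty`, stmt-Schanuel-6117)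

Crux `stmt-Schanuel-6117` (`Summit.Schanuel.Schanuel.Theses.DiophantineDichotomy.ApproximationProperty`),
route `DiophantineDichotomy`, line `orbit-interpolation-determinant`, lead c8
(`prover-line-stmt-Schanuel-6117-c8-0`, skeleton v19 `Cruxes/ApproximationProperty/Lines/orbit_interpolation_determinant.lean`).

This file LANDS, as real theorems with ONE explicit hypothesis (no `sorry`, no new definition, no
named fact), the kernel-checked `t = 3` content of skeleton v19. Compared with the c5/c6 records
(…PointAPThreeConditional.lean p129486, …Residuals.lean p130702: TWO hypotheses — Chardin–Philippon in
dimension `0` and the far-satellite datum beyond a threshold) two things changed: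
* Chardin–Philippon is DISCHARGED (`Literature.RingTheory.GradedAlgebra.chardinPhilippon_isolatedInterpolation_holds`,
  IsolatedComponentRegularityProofs.lean), and it is used here with FOUR forms (`clause_of_fourthForm`);
* the far stub is the v19 ENVELOPED form (`hfarEnv`, = registered stub `pointDatum_of_farSatellite3_env`
  verbatim): a long orbit of the thin clause-free descent (`cycleAP3DataThin` = the landed
  `stub_cycleAP3DataThin_of stub_boxAvoiding`, p135212 + p134153) failing the clause, lying on a THIN
  satellite `𝔮'` of degree `> δ⋆` which moreover ENVELOPS the orbit at level `⌊C₄Δ⌋`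
  (`ℚ[x]_{⌊C₄Δ⌋} ∩ 𝔭 ⊆ 𝔮'`), the constants `δ⋆, C₄` being at the hypothesis' disposal. The envelope
  costs nothing: by the landed `fourthForm_or_enveloped` (p136444) a non-enveloped orbit has a fourth
  form `g ∈ 𝔭` of degree `⌊C₄Δ⌋` with `𝔭` minimal over `(Q, P, T, g)`, and Chardin–Philippon with
  `k = 4` gives the clause at level `≤ (8 + C₄)Δ`, whence the landed good transfer.
So `PointAPAbsAt 3` — hence the approximation property for every `θ ∈ ℂ^ι` with `trdeg_ℚ ℚ(θ) ≤ 3`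
(`PointwiseAPSlice 3`, NOT in print: LNM 1752 Ch. 4 §4 p. 61 has AP2 for `n ≤ 2` only) — follows from
`hfarEnv` ALONE, and the whole crux from `hfarEnv` and `PointAPAbsAt t` for `t ≥ 4` (Philippon's
conjecture). `hfarEnv` is implied by `PointAPAbsAt 3` itself (ignore its hypotheses), so it is exactly
the open residual of the `t = 3` slice in this line.

Main results: `cycleAP3DataThin`, `clause_of_fourthForm`, `pointDatum_of_datum3_of_farEnv`,
`pointAPAt3_of_farEnv`, `slice_three_of_farEnv` and `approximationProperty_of_farEnv` (registered
sub-goals of the crux item), `pointAP_three_le_of_farEnv`.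

Sources: NesterenkoPhilippon2001 (LNM 1752) Ch. 3 §4, Ch. 4 §4 p. 61 (AP1 ⇒ AP2 scheme, AP2 proved
for `n ≤ 2` only); Philippon2000; ChardinPhilippon1999; LaurentRoy1999.
-/

set_option linter.dupNamespace false

namespace Summit.Schanuel.Schanuel.Cruxes.ApproximationProperty.OrbitInterpolationDeterminant

open Summit.Schanuel.Schanuel.Theses.DiophantineDichotomy
open Literature.NumberTheory.Transcendental.Nesterenko MvPolynomial
open scoped BigOperators

attribute [local instance] MvPolynomial.gradedAlgebra

noncomputable section

open PointAPThreeConditional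

/-- The thin clause-free descent, composed from the two LANDED v17 stubs:
`stub_cycleAP3DataThin_of stub_boxAvoiding` (…CycleAPIAt3DataThin.lean p135212, …BoxAvoiding.lean
p134153): for every `ω ∈ ℂ³` a constant `c ≥ 1` such that every scale `Y ≥ Δ ≥ c` carries a
`CycleAP3Datum` whose third cut `T` has degree `τ ≥ a + b + ⌊Δ⌋` and such that every minimal prime of
`(Q, P)` containing `T` is THIN, `dim ℚ[x]_τ < dim (ℚ[x]_τ ∩ 𝔮'') + 2⌊Δ⌋ deg 𝔮₂`.
[cite: NesterenkoPhilippon2001, Ch. 3 Prop. 4.7, 4.11, 4.13; Ch. 4 §4 p. 61] -/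
theorem cycleAP3DataThin : ∀ ω : Fin 3 → ℂ, ∃ c : ℝ, 1 ≤ c ∧ ∀ Δ Y : ℝ, c ≤ Δ → Δ ≤ Y →
    ∃ (Q : Rx 3) (a : ℕ) (P : Rx 3) (b : ℕ) (𝔮₂ : Ideal (Rx 3)) (T : Rx 3) (τ : ℕ)
      (𝔭 : Ideal (Rx 3)), CycleAP3Datum ω c Δ Y Q a P b 𝔮₂ T τ 𝔭 ∧ a + b + ⌊Δ⌋₊ ≤ τ ∧
      ∀ 𝔮'' ∈ (Ideal.span {Q} ⊔ Ideal.span {P}).minimalPrimes, T ∈ 𝔮'' →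
        Module.finrank ℚ ↥(homogeneousSubmodule (Fin (3 + 1)) ℚ τ) <
          Module.finrank ℚ ↥(homogeneousSubmodule (Fin (3 + 1)) ℚ τ ⊓ 𝔮''.restrictScalars ℚ) +
            2 * ⌊Δ⌋₊ * ideg 𝔮₂ 2 :=
  stub_cycleAP3DataThin_of stub_boxAvoiding

/-! ## Chardin–Philippon with four forms (glue over the discharged named fact) -/

/-- **Chardin–Philippon with `k = 4` forms** (glue over the DISCHARGED named fact
`Literature.RingTheory.GradedAlgebra.chardinPhilippon_isolatedInterpolation_holds`): if the orbit `𝔭`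
(homogeneous prime of rank `1`) is a minimal prime of `(Q, P, T, g)` for forms of degrees
`a, b, τ, ν₄ ≥ 1`, then it imposes independent conditions on the forms of every degree `ν` with
`a + b + τ + ν₄ + 1 ≤ ν + 3`. [cite: ChardinPhilippon1999, Théorème 1 + Corollaire 2(i)] -/
theorem clause_of_fourthForm (Q P T g : Rx 3) (a b τ ν₄ : ℕ) (hQ : Q.IsHomogeneous a)
    (hP : P.IsHomogeneous b) (hT : T.IsHomogeneous τ)
    (hg : g ∈ homogeneousSubmodule (Fin (3 + 1)) ℚ ν₄) (ha : 1 ≤ a) (hb : 1 ≤ b) (hτ : 1 ≤ τ)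
    (hν₄ : 1 ≤ ν₄) (𝔭 : Ideal (Rx 3)) (h𝔭p : 𝔭.IsPrime)
    (h𝔭h : 𝔭.IsHomogeneous (homogeneousSubmodule (Fin (3 + 1)) ℚ)) (h𝔭u : IsUnmixedOfRank 𝔭 1)
    (hmin : 𝔭 ∈ (Ideal.span (Set.range ![Q, P, T, g])).minimalPrimes) (ν : ℕ)
    (hν : a + b + τ + ν₄ + 1 ≤ ν + 3) :
    Module.finrank ℚ ↥(homogeneousSubmodule (Fin (3 + 1)) ℚ ν) =
      Module.finrank ℚ ↥(homogeneousSubmodule (Fin (3 + 1)) ℚ ν ⊓ 𝔭.restrictScalars ℚ) +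
        ideg 𝔭 1 := by
  refine Literature.RingTheory.GradedAlgebra.chardinPhilippon_isolatedInterpolation_holds 3 4
    ![Q, P, T, g] ![a, b, τ, ν₄] ?_ 𝔭 h𝔭p h𝔭h h𝔭u hmin ν ?_
  · intro j
    fin_cases j
    · exact ⟨hQ, ha⟩
    · exact ⟨hP, hb⟩
    · exact ⟨hT, hτ⟩
    · exact ⟨(mem_homogeneousSubmodule ν₄ g).mp hg, hν₄⟩
  · simp only [Fin.sum_univ_four, Matrix.cons_val_zero, Matrix.cons_val_one, Matrix.cons_val]
    omega

/-! ## The `t = 3` transfer from a descent datum (kernel-checked case tree over the stubs) -/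

/-- **The point datum from ANY datum of the thin clause-free descent, conditionally on the far
enveloped kernel `hfarEnv`** — skeleton v19's decomposition of the transfer: for every `ω` and `c₁ ≥ 1` there are `λ ≥ 1`, `c ≥ c₁` such that a `CycleAP3Datum` at the
boosted scale `(Δ, λY)` with constant `c₁` whose third cut certifies thin satellites yields a point
datum at `(Δ, Y)` with constant `c`. Case tree: (G) the clause for `𝔭` at level `⌊c₁Δ⌋` ⇒ the landed
per-scale transfer `pointDatum_of_clause` (dictionary + lever + sharp closest point) at the constant
`c₁g = max c₁ (C₄ + 24)`, after `clause_mono_level`; (¬G) the orbit is then long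
(`rankOne_interpolation_of_ideg_le`), and `fourthForm_or_enveloped` at the level `ν₄ = ⌊C₄Δ⌋` splits:
(CP4) a form `g ∈ 𝔭` of degree `ν₄` with `𝔭` minimal over `(Q, P, T, g)` ⇒ Chardin–Philippon with
`k = 4` (`clause_of_fourthForm`) ⇒ clause at `⌊c₁g Δ⌋ ≥ a + b + τ + ν₄ − 2` ⇒ transfer (this absorbs
v10–v18's isolated case (I)); (ENV) a satellite `𝔮'` enveloping the orbit at level `ν₄`: (L) of degree
`1` ⇒ `pointDatum_of_lineSatellite3_log` (log floor + restart); (B) of degree `≤ δ⋆` ⇒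
`pointDatum_of_boundedSatellite3` (log floor + satellite height + restart); (F) of degree `> δ⋆` ⇒
the hypothesis `hfarEnv` (the registered open stub `pointDatum_of_farSatellite3_env` of the skeleton, spelled out; consulted FIRST, since it fixes `δ⋆ = δ⋆(ω, c₁)` and
`C₄ = C₄(ω, c₁)`; it receives the thinness certified by the datum and the envelope). The four boosts
are multiplied and each branch's datum at `(Δ, λ'Y)` is a datum at `(Δ, Y)` by `datum_mono`.
[cite: NesterenkoPhilippon2001, Ch. 4 §4 p. 61 (AP1 ⇒ AP2 scheme); ChardinPhilippon1999] -/
theorem pointDatum_of_datum3_of_farEnv (hfarEnv : ∀ (ω : Fin 3 → ℂ) (c₁ : ℝ), 1 ≤ c₁ → ∃ δstar : ℕ, 1 ≤ δstar ∧ ∃ C₄ : ℝ, 1 ≤ C₄ ∧ ∃ lam : ℝ, 1 ≤ lam ∧ ∃ c : ℝ, c₁ ≤ c ∧ ∀ Δ Y : ℝ, c ≤ Δ → Δ ≤ Y → ∀ (Q : Rx 3) (a : ℕ) (P : Rx 3) (b : ℕ) (𝔮 : Ideal (Rx 3)) (T : Rx 3) (τ : ℕ) (𝔭 𝔮' : Ideal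 (Rx 3)), CycleAP3Datum ω c₁ Δ (lam * Y) Q a P b 𝔮 T τ 𝔭 → 𝔮'.IsPrime → 𝔮'.IsHomogeneous (homogeneousSubmodule (Fin (3 + 1)) ℚ) → IsUnmixedOfRank 𝔮' 2 → 𝔮' ∈ (Ideal.span {Q} ⊔ Ideal.span {P}).minimalPrimes → Ideal.span {Q} ⊔ Ideal.span {P} ⊔ Ideal.span {T} ≤ 𝔮' → 𝔮' < 𝔭 → δstar < ideg 𝔮' 2 → a + b + ⌊Δ⌋₊ ≤ τ → Module.finrank ℚ ↥(homogeneousSubmodule (Fin (3 + 1)) ℚ τ) < Module.finrank ℚ ↥(homogeneousSubmodule (Fin (3 + 1)) ℚ τ ⊓ 𝔮'.restrictScalars ℚ) + 2 * ⌊Δ⌋₊ * ideg 𝔮 2 → ⌊c₁ * Δ⌋₊ + 1 < ideg 𝔭 1 → ¬ (Module.finrank ℚ ↥(homogeneousSubmodule (Fin (3 + 1)) ℚ ⌊c₁ * Δ⌋₊) = Module.finrank ℚ ↥(homogeneousSubmodule (Fin (3 + 1)) ℚ ⌊c₁ * Δ⌋₊ ⊓ 𝔭.restrictScalars ℚ)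 + ideg 𝔭 1) → homogeneousSubmodule (Fin (3 + 1)) ℚ ⌊C₄ * Δ⌋₊ ⊓ 𝔭.restrictScalars ℚ ≤ 𝔮'.restrictScalars ℚ → ∃ (K : Type) (_ : Field K) (_ : NumberField K) (β : Fin 3 → K) (σ : K →+* ℂ), (Module.finrank ℚ K : ℝ) ≤ (c * Δ) ^ 3 ∧ Height.logHeight (Fin.cons (1 : K) β : Fin (3 + 1) → K) ≤ c * Y * Δ ^ 2 ∧ ‖(fun j => σ (β j)) - ω‖ ≤ Real.exp (-((Δ * Height.logHeight (Fin.cons (1 : K) β : Fin (3 + 1) → K) + Y * Module.finrank ℚ K) / c))) :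
    ∀ (ω : Fin 3 → ℂ) (c₁ : ℝ), 1 ≤ c₁ → ∃ lam : ℝ, 1 ≤ lam ∧
    ∃ c : ℝ, c₁ ≤ c ∧ ∀ Δ Y : ℝ, c ≤ Δ → Δ ≤ Y →
    ∀ (Q : Rx 3) (a : ℕ) (P : Rx 3) (b : ℕ) (𝔮 : Ideal (Rx 3)) (T : Rx 3) (τ : ℕ)
      (𝔭 : Ideal (Rx 3)), CycleAP3Datum ω c₁ Δ (lam * Y) Q a P b 𝔮 T τ 𝔭 → a + b + ⌊Δ⌋₊ ≤ τ →
    (∀ 𝔮'' ∈ (Ideal.span {Q} ⊔ Ideal.span {P}).minimalPrimes, T ∈ 𝔮'' →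
      Module.finrank ℚ ↥(homogeneousSubmodule (Fin (3 + 1)) ℚ τ) <
        Module.finrank ℚ ↥(homogeneousSubmodule (Fin (3 + 1)) ℚ τ ⊓ 𝔮''.restrictScalars ℚ) +
          2 * ⌊Δ⌋₊ * ideg 𝔮 2) →
    ∃ (K : Type) (_ : Field K) (_ : NumberField K) (β : Fin 3 → K) (σ : K →+* ℂ),
      (Module.finrank ℚ K : ℝ) ≤ (c * Δ) ^ 3 ∧
      Height.logHeight (Fin.cons (1 : K) β : Fin (3 + 1) → K) ≤ c * Y * Δ ^ 2 ∧
      ‖(fun j => σ (β j)) - ω‖ ≤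
        Real.exp (-((Δ * Height.logHeight (Fin.cons (1 : K) β : Fin (3 + 1) → K) +
          Y * Module.finrank ℚ K) / c)) := by
  intro ω c₁ hc₁
  classical
  have hc₁0 : 0 < c₁ := by linarith
  -- the far branch FIRST: it fixes the satellite threshold `δ⋆` and the envelope constant `C₄`
  obtain ⟨δs, hδs1, C₄, hC₄1, lf, hlf1, cf, hcf, hfar⟩ := hfarEnv ω c₁ hc₁
  -- the good-transfer constant `c₁g = max c₁ (C₄ + 24)` (level `⌊c₁g Δ⌋ ≥ a + b + τ + ⌊C₄Δ⌋ − 2`)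
  set c₁g : ℝ := max c₁ (C₄ + 24) with hc₁gdef
  have hc₁c₁g : c₁ ≤ c₁g := le_max_left _ _
  have h24 : C₄ + 24 ≤ c₁g := le_max_right _ _
  have hc₁g1 : 1 ≤ c₁g := hc₁.trans hc₁c₁g
  -- the three other branch transfers
  obtain ⟨lg, hlg1, cg, hcg, hgood⟩ := pointDatum_of_clause 3 (by norm_num) stub_zeroDimDictionary
    (stub_sharpClosestPoint stub_orbitClusterBound stub_zeroDimDictionary) ω c₁g hc₁g1
  obtain ⟨ll, hll1, cl, hcl, hline⟩ := pointDatum_of_lineSatellite3_log orbitFloorLog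
    stub_satelliteHeightLine stub_containerRestart ω c₁ hc₁
  obtain ⟨lb, hlb1, cb, hcb, hbdd⟩ := pointDatum_of_boundedSatellite3 orbitFloorLog
    stub_satelliteHeight stub_containerRestart δs hδs1 ω c₁ hc₁
  have hcg1 : 1 ≤ cg := hc₁g1.trans hcg
  have hcl1 : 1 ≤ cl := hc₁.trans hcl
  have hcb1 : 1 ≤ cb := hc₁.trans hcb
  have hcf1 : 1 ≤ cf := hc₁.trans hcf
  have hlg0 : 0 < lg := by linarith
  have hll0 : 0 < ll := by linarith
  have hlb0 : 0 < lb := by linarith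
  have hlf0 : 0 < lf := by linarith
  -- per-branch co-boosts (the product of the other three boosts)
  obtain ⟨mg, hmg⟩ : ∃ mg : ℝ, mg = ll * lb * lf := ⟨_, rfl⟩
  obtain ⟨ml, hml⟩ : ∃ ml : ℝ, ml = lg * lb * lf := ⟨_, rfl⟩
  obtain ⟨mb, hmb⟩ : ∃ mb : ℝ, mb = lg * ll * lf := ⟨_, rfl⟩
  obtain ⟨mf, hmf⟩ : ∃ mf : ℝ, mf = lg * ll * lb := ⟨_, rfl⟩
  have hmg1 : 1 ≤ mg :=
    hmg ▸ one_le_mul_of_one_le_of_one_le (one_le_mul_of_one_le_of_one_le hll1 hlb1) hlf1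
  have hml1 : 1 ≤ ml :=
    hml ▸ one_le_mul_of_one_le_of_one_le (one_le_mul_of_one_le_of_one_le hlg1 hlb1) hlf1
  have hmb1 : 1 ≤ mb :=
    hmb ▸ one_le_mul_of_one_le_of_one_le (one_le_mul_of_one_le_of_one_le hlg1 hll1) hlf1
  have hmf1 : 1 ≤ mf :=
    hmf ▸ one_le_mul_of_one_le_of_one_le (one_le_mul_of_one_le_of_one_le hlg1 hll1) hlb1
  have hmg0 : 0 ≤ mg := by linarith
  have hml0 : 0 ≤ ml := by linarith
  have hmb0 : 0 ≤ mb := by linarith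
  have hmf0 : 0 ≤ mf := by linarith
  -- total boost and final constant
  refine ⟨lg * ll * lb * lf, one_le_mul_of_one_le_of_one_le
    (one_le_mul_of_one_le_of_one_le (one_le_mul_of_one_le_of_one_le hlg1 hll1) hlb1) hlf1, ?_⟩
  obtain ⟨C, hCdef⟩ : ∃ C : ℝ, C = cg * mg + cl * ml + cb * mb + cf * mf := ⟨_, rfl⟩
  have tg : 0 ≤ cg * mg := by positivity
  have tl : 0 ≤ cl * ml := by positivity
  have tb : 0 ≤ cb * mb := by positivity
  have tf : 0 ≤ cf * mf := by positivity
  have hCg : cg * mg ≤ C := by rw [hCdef]; linarith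
  have hCl : cl * ml ≤ C := by rw [hCdef]; linarith
  have hCb : cb * mb ≤ C := by rw [hCdef]; linarith
  have hCf : cf * mf ≤ C := by rw [hCdef]; linarith
  have hcgC : cg ≤ C := le_trans (le_mul_of_one_le_right (by linarith) hmg1) hCg
  have hclC : cl ≤ C := le_trans (le_mul_of_one_le_right (by linarith) hml1) hCl
  have hcbC : cb ≤ C := le_trans (le_mul_of_one_le_right (by linarith) hmb1) hCb
  have hcfC : cf ≤ C := le_trans (le_mul_of_one_le_right (by linarith) hmf1) hCf
  refine ⟨C, hc₁c₁g.trans (hcg.trans hcgC), ?_⟩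
  intro Δ Y hΔ hY Q a P b 𝔮 T τ 𝔭 hd hτab hthin
  have hC1 : 1 ≤ C := hcg1.trans hcgC
  have hΔ1 : 1 ≤ Δ := hC1.trans hΔ
  have hΔ0 : 0 ≤ Δ := by linarith
  have hY0 : 0 ≤ Y := by linarith
  have hcgΔ : cg ≤ Δ := hcgC.trans hΔ
  have hclΔ : cl ≤ Δ := hclC.trans hΔ
  have hcbΔ : cb ≤ Δ := hcbC.trans hΔ
  have hcfΔ : cf ≤ Δ := hcfC.trans hΔ
  -- the four per-branch scales `m_x · Y`
  have hYg : Y ≤ mg * Y := le_mul_of_one_le_left hY0 hmg1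
  have hYl : Y ≤ ml * Y := le_mul_of_one_le_left hY0 hml1
  have hYb : Y ≤ mb * Y := le_mul_of_one_le_left hY0 hmb1
  have hYf : Y ≤ mf * Y := le_mul_of_one_le_left hY0 hmf1
  have hΔYg : Δ ≤ mg * Y := hY.trans hYg
  have hΔYl : Δ ≤ ml * Y := hY.trans hYl
  have hΔYb : Δ ≤ mb * Y := hY.trans hYb
  have hΔYf : Δ ≤ mf * Y := hY.trans hYf
  have eg : lg * ll * lb * lf * Y = lg * (mg * Y) := by rw [hmg]; ring
  have el : lg * ll * lb * lf * Y = ll * (ml * Y) := by rw [hml]; ring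
  have eb : lg * ll * lb * lf * Y = lb * (mb * Y) := by rw [hmb]; ring
  have ef : lg * ll * lb * lf * Y = lf * (mf * Y) := by rw [hmf]; ring
  -- unpack the datum (keeping a folded copy for the far branch)
  have hdfull := hd
  obtain ⟨hQ0, hQa, ha1, haΔ, hQp, hPb, hb1, hbΔ, hPQ, h𝔮p, h𝔮h, h𝔮u, hQ𝔮, hP𝔮, -, -, -, hTτ, hτ1,
    hτΔ, hT𝔮, h𝔭p, h𝔭h, h𝔭u, h𝔮𝔭, hT𝔭, -, hdeg, hht, habs⟩ := hd
  have hspan : Ideal.span {Q} ⊔ Ideal.span {P} ⊔ Ideal.span {T} ≤ 𝔭 :=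
    sup_le (sup_le ((Ideal.span_singleton_le_iff_mem _).mpr (h𝔮𝔭 hQ𝔮))
      ((Ideal.span_singleton_le_iff_mem _).mpr (h𝔮𝔭 hP𝔮)))
      ((Ideal.span_singleton_le_iff_mem _).mpr hT𝔭)
  -- (G): the good transfer at constant `c₁g`, given the clause at level `⌊c₁g Δ⌋`
  have good : Module.finrank ℚ ↥(homogeneousSubmodule (Fin (3 + 1)) ℚ ⌊c₁g * Δ⌋₊) =
      Module.finrank ℚ ↥(homogeneousSubmodule (Fin (3 + 1)) ℚ ⌊c₁g * Δ⌋₊ ⊓ 𝔭.restrictScalars ℚ) +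
        ideg 𝔭 1 →
      ∃ (K : Type) (_ : Field K) (_ : NumberField K) (β : Fin 3 → K) (σ : K →+* ℂ),
        (Module.finrank ℚ K : ℝ) ≤ (C * Δ) ^ 3 ∧
        Height.logHeight (Fin.cons (1 : K) β : Fin (3 + 1) → K) ≤ C * Y * Δ ^ 2 ∧
        ‖(fun j => σ (β j)) - ω‖ ≤
          Real.exp (-((Δ * Height.logHeight (Fin.cons (1 : K) β : Fin (3 + 1) → K) +
            Y * Module.finrank ℚ K) / C)) := by
    intro hcl'
    have hY' : 0 ≤ lg * (mg * Y) := by positivity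
    obtain ⟨hdeg', hht', habs'⟩ := orbitBounds_mono (𝔭 := 𝔭) (ω := ω) hc₁ hc₁c₁g hΔ0 hY'
      hdeg (by rw [← eg]; exact hht) (by rw [← eg]; exact habs)
    have hdat := hgood Δ (mg * Y) hcgΔ hΔYg 𝔭 h𝔭p h𝔭h h𝔭u hdeg'
      (by simpa [mul_comm, mul_left_comm, mul_assoc] using hht')
      (by simpa [mul_comm, mul_left_comm, mul_assoc] using habs') hcl'
    exact datum_mono hcg1 hcgC hΔ0 hY0 hYg
      (by calc cg * (mg * Y) = cg * mg * Y := by ring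
          _ ≤ C * Y := mul_le_mul_of_nonneg_right hCg hY0) hdat
  by_cases hclause : Module.finrank ℚ ↥(homogeneousSubmodule (Fin (3 + 1)) ℚ ⌊c₁ * Δ⌋₊) =
      Module.finrank ℚ ↥(homogeneousSubmodule (Fin (3 + 1)) ℚ ⌊c₁ * Δ⌋₊ ⊓ 𝔭.restrictScalars ℚ) +
        ideg 𝔭 1
  · -- (G) the clause at `⌊c₁Δ⌋`, hence at `⌊c₁g Δ⌋`
    exact good (clause_mono_level 3 𝔭 h𝔭p h𝔭h h𝔭u _ _
      (Nat.floor_le_floor (mul_le_mul_of_nonneg_right hc₁c₁g hΔ0)) hclause)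
  · -- (¬G): the orbit is long
    have hlong : ⌊c₁ * Δ⌋₊ + 1 < ideg 𝔭 1 := by
      by_contra hsh
      exact hclause (rankOne_interpolation_of_ideg_le 3 𝔭 _ h𝔭p h𝔭h h𝔭u (not_lt.mp hsh))
    -- the envelope level `ν₄ = ⌊C₄ Δ⌋ ≥ 1`
    have hC₄Δ : (1 : ℝ) ≤ C₄ * Δ := one_le_mul_of_one_le_of_one_le hC₄1 hΔ1
    have hν₄1 : 1 ≤ ⌊C₄ * Δ⌋₊ := Nat.le_floor (by exact_mod_cast hC₄Δ)
    rcases fourthForm_or_enveloped Q P T a b τ hQ0 hQa hPb hTτ ha1 hb1 hτ1 hQp hPQ 𝔭 h𝔭p h𝔭h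
      h𝔭u hspan ⌊C₄ * Δ⌋₊ with ⟨g, hgν, hg𝔭, hmin4⟩ | ⟨𝔮', h𝔮'p, h𝔮'h, h𝔮'u, h𝔮'min, h𝔮'le, h𝔮'lt, henv⟩
    · -- (CP4) an isolated point of FOUR hypersurfaces: Chardin–Philippon at level `⌊c₁g Δ⌋`
      refine good (clause_of_fourthForm Q P T g a b τ ⌊C₄ * Δ⌋₊ hQa hPb hTτ hgν ha1 hb1 hτ1 hν₄1
        𝔭 h𝔭p h𝔭h h𝔭u hmin4 _ ?_)
      -- `a + b + τ + ⌊C₄Δ⌋ + 1 ≤ ⌊c₁g Δ⌋ + 3` from `a + b + τ ≤ 8Δ` and `c₁g ≥ C₄ + 24`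
      have h8 : (a : ℝ) + b + τ ≤ 8 * Δ := by linarith only [haΔ, hbΔ, hτΔ]
      have hν₄ : (⌊C₄ * Δ⌋₊ : ℝ) ≤ C₄ * Δ := Nat.floor_le (by positivity)
      have h1 : c₁g * Δ - 1 < ⌊c₁g * Δ⌋₊ := Nat.sub_one_lt_floor (c₁g * Δ)
      have h2 : (C₄ + 24) * Δ ≤ c₁g * Δ := mul_le_mul_of_nonneg_right h24 hΔ0
      have : ((a + b + τ + ⌊C₄ * Δ⌋₊ + 1 : ℕ) : ℝ) ≤ ((⌊c₁g * Δ⌋₊ + 3 : ℕ) : ℝ) := by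
        push_cast; nlinarith only [h8, hν₄, h1, h2, hΔ1]
      exact_mod_cast this
    · -- (ENV) a satellite `𝔮'` enveloping the orbit: `Q, P, T ∈ 𝔮'`, `𝔮' ≤ 𝔭`
      have hQ𝔮' : Q ∈ 𝔮' := h𝔮'le (Ideal.mem_sup_left (Ideal.mem_sup_left (Ideal.mem_span_singleton_self Q)))
      have hP𝔮' : P ∈ 𝔮' := h𝔮'le (Ideal.mem_sup_left (Ideal.mem_sup_right (Ideal.mem_span_singleton_self P)))
      have hab : (a : ℝ) + b ≤ 3 * Δ := by linarith only [haΔ, hbΔ]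
      by_cases hlineCase : ideg 𝔮' 2 = 1
      · -- (L) line satellite: log floor + restart, at the scale `(Δ, ml Y)`
        have hdat := hline Δ (ml * Y) hclΔ hΔYl Q a P b 𝔮' 𝔭 hQ0 hQa hPb ha1 hb1 hab hQp hPQ
          h𝔮'p h𝔮'h h𝔮'u hQ𝔮' hP𝔮' hlineCase h𝔭p h𝔭h h𝔭u h𝔮'lt.le hlong hdeg
          (by rw [← el]; exact hht) (by rw [← el]; exact habs)
        exact datum_mono hcl1 hclC hΔ0 hY0 hYl
          (by calc cl * (ml * Y) = cl * ml * Y := by ring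
              _ ≤ C * Y := mul_le_mul_of_nonneg_right hCl hY0) hdat
      · by_cases hbddCase : ideg 𝔮' 2 ≤ δs
        · -- (B) bounded-degree satellite: log floor + satellite height + restart, scale `(Δ, mb Y)`
          have hdat := hbdd Δ (mb * Y) hcbΔ hΔYb Q a P b 𝔮' 𝔭 hQ0 hQa hPb ha1 hb1 hab hQp hPQ
            h𝔮'p h𝔮'h h𝔮'u hQ𝔮' hP𝔮' hbddCase h𝔭p h𝔭h h𝔭u h𝔮'lt.le hlong hdeg
            (by rw [← eb]; exact hht) (by rw [← eb]; exact habs)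
          exact datum_mono hcb1 hcbC hΔ0 hY0 hYb
            (by calc cb * (mb * Y) = cb * mb * Y := by ring
                _ ≤ C * Y := mul_le_mul_of_nonneg_right hCb hY0) hdat
        · -- (F) far enveloping satellite (degree `> δ⋆`): the open kernel, at the scale `(Δ, mf Y)`
          have hfarCase : δs < ideg 𝔮' 2 := not_le.mp hbddCase
          have hd' : CycleAP3Datum ω c₁ Δ (lf * (mf * Y)) Q a P b 𝔮 T τ 𝔭 := by
            rw [← ef]; exact hdfull
          have hT𝔮' : T ∈ 𝔮' := h𝔮'le (Ideal.mem_sup_right (Ideal.mem_span_singleton_self T))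
          have hdat := hfar Δ (mf * Y) hcfΔ hΔYf Q a P b 𝔮 T τ 𝔭 𝔮' hd' h𝔮'p h𝔮'h h𝔮'u h𝔮'min
            h𝔮'le h𝔮'lt hfarCase hτab (hthin 𝔮' h𝔮'min hT𝔮') hlong hclause henv
          exact datum_mono hcf1 hcfC hΔ0 hY0 hYf
            (by calc cf * (mf * Y) = cf * mf * Y := by ring
                _ ≤ C * Y := mul_le_mul_of_nonneg_right hCf hY0) hdat

/-- **`PointAPAbsAt 3` from the far enveloped kernel alone** — Philippon's AP2 for `n = 3` with
pointwise constants, assembled from the thin clause-free descent with its data (`cycleAP3DataThin`)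
run at the boosted scale `(Δ, λY)` and the transfer `pointDatum_of_datum3_of_farEnv`.
[cite: NesterenkoPhilippon2001, Ch. 4 §4 p. 61] -/
theorem pointAPAt3_of_farEnv (hfarEnv : ∀ (ω : Fin 3 → ℂ) (c₁ : ℝ), 1 ≤ c₁ → ∃ δstar : ℕ, 1 ≤ δstar ∧ ∃ C₄ : ℝ, 1 ≤ C₄ ∧ ∃ lam : ℝ, 1 ≤ lam ∧ ∃ c : ℝ, c₁ ≤ c ∧ ∀ Δ Y : ℝ, c ≤ Δ → Δ ≤ Y → ∀ (Q : Rx 3) (a : ℕ) (P : Rx 3) (b : ℕ) (𝔮 : Ideal (Rx 3)) (T : Rx 3) (τ : ℕ) (𝔭 𝔮' : Ideal (Rx 3)), CycleAP3Datum ω c₁ Δ (lam * Y) Q a P b 𝔮 T τ 𝔭 → 𝔮'.IsPrime → 𝔮'.IsHomogeneous (homogeneousSubmodule (Fin (3 + 1)) ℚ) → IsUnmixedOfRank 𝔮' 2 → 𝔮' ∈ (Ideal.span {Q} ⊔ Ideal.span {P}).minimalPrimes → Ideal.span {Q} ⊔ Ideal.span {P} ⊔ Ideal.span {T} ≤ 𝔮'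 → 𝔮' < 𝔭 → δstar < ideg 𝔮' 2 → a + b + ⌊Δ⌋₊ ≤ τ → Module.finrank ℚ ↥(homogeneousSubmodule (Fin (3 + 1)) ℚ τ) < Module.finrank ℚ ↥(homogeneousSubmodule (Fin (3 + 1)) ℚ τ ⊓ 𝔮'.restrictScalars ℚ) + 2 * ⌊Δ⌋₊ * ideg 𝔮 2 → ⌊c₁ * Δ⌋₊ + 1 < ideg 𝔭 1 → ¬ (Module.finrank ℚ ↥(homogeneousSubmodule (Fin (3 + 1)) ℚ ⌊c₁ * Δ⌋₊) = Module.finrank ℚ ↥(homogeneousSubmodule (Fin (3 + 1)) ℚ ⌊c₁ * Δ⌋₊ ⊓ 𝔭.restrictScalars ℚ) + ideg 𝔭 1) → homogeneousSubmodule (Fin (3 + 1)) ℚ ⌊C₄ * Δ⌋₊ ⊓ 𝔭.restrictScalars ℚ ≤ 𝔮'.restrictScalars ℚ → ∃ (K : Type) (_ : Field K) (_ : NumberField K) (β : Fin 3 → K) (σ : K →+* ℂ), (Module.finrank ℚ K : ℝ) ≤ (c * Δ) ^ 3 ∧ Height.logHeight (Fin.cons (1 : K) β : Fin (3 + 1)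 → K) ≤ c * Y * Δ ^ 2 ∧ ‖(fun j => σ (β j)) - ω‖ ≤ Real.exp (-((Δ * Height.logHeight (Fin.cons (1 : K) β : Fin (3 + 1) → K) + Y * Module.finrank ℚ K) / c))) :
    PointAPAbsAt 3 := by
  intro ω
  classical
  obtain ⟨c₀, hc₀1, hdata⟩ := cycleAP3DataThin ω
  obtain ⟨lam, hlam1, c, hc, htrans⟩ := pointDatum_of_datum3_of_farEnv hfarEnv ω c₀ hc₀1
  have hc1 : 1 ≤ c := hc₀1.trans hc
  refine ⟨c, hc1, fun Δ Y hΔ hY => ?_⟩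
  have hY0 : 0 ≤ Y := by linarith [hc1.trans hΔ]
  have hΔY' : Δ ≤ lam * Y := hY.trans (le_mul_of_one_le_left hY0 hlam1)
  obtain ⟨Q, a, P, b, 𝔮, T, τ, 𝔭, hd, hτab, hthin⟩ := hdata Δ (lam * Y) (hc.trans hΔ) hΔY'
  exact htrans Δ Y hΔ hY Q a P b 𝔮 T τ 𝔭 hd hτab hthin

/-- **Registered sub-goal `slice_three_of_farEnv` — the `t = 3` slice of the crux from the far
enveloped kernel alone**: the approximation property for EVERY `θ ∈ ℂ^ι` with `trdeg_ℚ ℚ(θ) ≤ 3`, all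
scales, output-dependent accuracy (NOT in print), via `pointAPAt3_of_farEnv`, the landed `t ≤ 2` point
properties and the landed lifting `stub_lift`.
[cite: NesterenkoPhilippon2001, Ch. 4 §4 p. 61; LaurentRoy1999, Thm 1] -/
theorem slice_three_of_farEnv : (∀ (ω : Fin 3 → ℂ) (c₁ : ℝ), 1 ≤ c₁ → ∃ δstar : ℕ, 1 ≤ δstar ∧ ∃ C₄ : ℝ, 1 ≤ C₄ ∧ ∃ lam : ℝ, 1 ≤ lam ∧ ∃ c : ℝ, c₁ ≤ c ∧ ∀ Δ Y : ℝ, c ≤ Δ → Δ ≤ Y → ∀ (Q : Rx 3) (a : ℕ) (P : Rx 3) (b : ℕ) (𝔮 : Ideal (Rx 3)) (T : Rx 3) (τ : ℕ) (𝔭 𝔮' : Ideal (Rx 3)), CycleAP3Datum ω c₁ Δ (lam * Y) Q a P b 𝔮 T τ 𝔭 → 𝔮'.IsPrime → 𝔮'.IsHomogeneous (homogeneousSubmodule (Fin (3 + 1)) ℚ) → IsUnmixedOfRank 𝔮' 2 → 𝔮' ∈ (Ideal.span {Q} ⊔ Ideal.span {P}).minimalPrimes → Ideal.span {Q} ⊔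 Ideal.span {P} ⊔ Ideal.span {T} ≤ 𝔮' → 𝔮' < 𝔭 → δstar < ideg 𝔮' 2 → a + b + ⌊Δ⌋₊ ≤ τ → Module.finrank ℚ ↥(homogeneousSubmodule (Fin (3 + 1)) ℚ τ) < Module.finrank ℚ ↥(homogeneousSubmodule (Fin (3 + 1)) ℚ τ ⊓ 𝔮'.restrictScalars ℚ) + 2 * ⌊Δ⌋₊ * ideg 𝔮 2 → ⌊c₁ * Δ⌋₊ + 1 < ideg 𝔭 1 → ¬ (Module.finrank ℚ ↥(homogeneousSubmodule (Fin (3 + 1)) ℚ ⌊c₁ * Δ⌋₊) = Module.finrank ℚ ↥(homogeneousSubmodule (Fin (3 + 1)) ℚ ⌊c₁ * Δ⌋₊ ⊓ 𝔭.restrictScalars ℚ) + ideg 𝔭 1) → homogeneousSubmodule (Fin (3 + 1)) ℚ ⌊C₄ * Δ⌋₊ ⊓ 𝔭.restrictScalars ℚ ≤ 𝔮'.restrictScalars ℚ → ∃ (K : Type) (_ : Field K) (_ : NumberField K) (β : Fin 3 → K) (σ : K →+* ℂ), (Module.finrank ℚ K : ℝ) ≤ (c * Δ) ^ 3 ∧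 Height.logHeight (Fin.cons (1 : K) β : Fin (3 + 1) → K) ≤ c * Y * Δ ^ 2 ∧ ‖(fun j => σ (β j)) - ω‖ ≤ Real.exp (-((Δ * Height.logHeight (Fin.cons (1 : K) β : Fin (3 + 1) → K) + Y * Module.finrank ℚ K) / c))) → PointwiseAPSlice 3 := by
  intro hfarEnv
  exact stub_lift 3 (by norm_num) fun t₀ h₀ h₀3 =>
    if h₂ : t₀ ≤ 2 then PointAPThreeConditional.pointAP_le_two t₀ h₀ h₂
    else (show t₀ = 3 by omega) ▸ pointAPAt3_of_farEnv hfarEnv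

/-- The point property in every dimension `t ≥ 3` from the far enveloped kernel and the `t ≥ 4` point
property (Philippon's conjecture, taken as a hypothesis). -/
theorem pointAP_three_le_of_farEnv (hfarEnv : ∀ (ω : Fin 3 → ℂ) (c₁ : ℝ), 1 ≤ c₁ → ∃ δstar : ℕ, 1 ≤ δstar ∧ ∃ C₄ : ℝ, 1 ≤ C₄ ∧ ∃ lam : ℝ, 1 ≤ lam ∧ ∃ c : ℝ, c₁ ≤ c ∧ ∀ Δ Y : ℝ, c ≤ Δ → Δ ≤ Y → ∀ (Q : Rx 3) (a : ℕ) (P : Rx 3) (b : ℕ) (𝔮 : Ideal (Rx 3)) (T : Rx 3) (τ : ℕ) (𝔭 𝔮' : Ideal (Rx 3)), CycleAP3Datum ω c₁ Δ (lam * Y) Q a P b 𝔮 T τ 𝔭 → 𝔮'.IsPrime → 𝔮'.IsHomogeneous (homogeneousSubmodule (Fin (3 + 1)) ℚ) → IsUnmixedOfRank 𝔮' 2 → 𝔮' ∈ (Ideal.span {Q} ⊔ Ideal.span {P}).minimalPrimes → Ideal.span {Q} ⊔ Ideal.span {P} ⊔ Ideal.span {T} ≤ 𝔮' → 𝔮'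 < 𝔭 → δstar < ideg 𝔮' 2 → a + b + ⌊Δ⌋₊ ≤ τ → Module.finrank ℚ ↥(homogeneousSubmodule (Fin (3 + 1)) ℚ τ) < Module.finrank ℚ ↥(homogeneousSubmodule (Fin (3 + 1)) ℚ τ ⊓ 𝔮'.restrictScalars ℚ) + 2 * ⌊Δ⌋₊ * ideg 𝔮 2 → ⌊c₁ * Δ⌋₊ + 1 < ideg 𝔭 1 → ¬ (Module.finrank ℚ ↥(homogeneousSubmodule (Fin (3 + 1)) ℚ ⌊c₁ * Δ⌋₊) = Module.finrank ℚ ↥(homogeneousSubmodule (Fin (3 + 1)) ℚ ⌊c₁ * Δ⌋₊ ⊓ 𝔭.restrictScalars ℚ) + ideg 𝔭 1) → homogeneousSubmodule (Fin (3 + 1)) ℚ ⌊C₄ * Δ⌋₊ ⊓ 𝔭.restrictScalars ℚ ≤ 𝔮'.restrictScalars ℚ → ∃ (K : Type) (_ : Field K) (_ : NumberField K) (β : Fin 3 → K) (σ : K →+* ℂ), (Module.finrank ℚ K : ℝ) ≤ (c * Δ) ^ 3 ∧ Height.logHeight (Fin.cons (1 : K) β : Fin (3 + 1) → K) ≤ c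 * Y * Δ ^ 2 ∧ ‖(fun j => σ (β j)) - ω‖ ≤ Real.exp (-((Δ * Height.logHeight (Fin.cons (1 : K) β : Fin (3 + 1) → K) + Y * Module.finrank ℚ K) / c)))
    (h4 : ∀ t : ℕ, 4 ≤ t → PointAPAbsAt t) : ∀ t : ℕ, 3 ≤ t → PointAPAbsAt t := fun t ht =>
  if e₃ : t = 3 then e₃ ▸ pointAPAt3_of_farEnv hfarEnv else h4 t (by omega)

/-- **Registered sub-goal `approximationProperty_of_farEnv` — the crux's exact residual after v19**:
`ApproximationProperty` (all `θ`, all `t ≥ 1` with `trdeg_ℚ ℚ(θ) ≤ t`) from the far enveloped kernel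
at `n = 3` and the point property `PointAPAbsAt t` for `t ≥ 4` (Philippon's conjecture AP1/AP2,
`n ≥ 4`), everything else being in the tree (`approximationProperty_of_pointAP_three_le`, p130702).
[cite: NesterenkoPhilippon2001, Ch. 4 §4 p. 61] -/
theorem approximationProperty_of_farEnv : (∀ (ω : Fin 3 → ℂ) (c₁ : ℝ), 1 ≤ c₁ → ∃ δstar : ℕ, 1 ≤ δstar ∧ ∃ C₄ : ℝ, 1 ≤ C₄ ∧ ∃ lam : ℝ, 1 ≤ lam ∧ ∃ c : ℝ, c₁ ≤ c ∧ ∀ Δ Y : ℝ, c ≤ Δ → Δ ≤ Y → ∀ (Q : Rx 3) (a : ℕ) (P : Rx 3) (b : ℕ) (𝔮 : Ideal (Rx 3)) (T : Rx 3) (τ : ℕ) (𝔭 𝔮' : Ideal (Rx 3)), CycleAP3Datum ω c₁ Δ (lam * Y) Q a P b 𝔮 T τ 𝔭 → 𝔮'.IsPrime → 𝔮'.IsHomogeneous (homogeneousSubmodule (Fin (3 + 1)) ℚ) → IsUnmixedOfRank 𝔮' 2 → 𝔮' ∈ (Ideal.span {Q} ⊔ Ideal.span {P}).minimalPrimes →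 Ideal.span {Q} ⊔ Ideal.span {P} ⊔ Ideal.span {T} ≤ 𝔮' → 𝔮' < 𝔭 → δstar < ideg 𝔮' 2 → a + b + ⌊Δ⌋₊ ≤ τ → Module.finrank ℚ ↥(homogeneousSubmodule (Fin (3 + 1)) ℚ τ) < Module.finrank ℚ ↥(homogeneousSubmodule (Fin (3 + 1)) ℚ τ ⊓ 𝔮'.restrictScalars ℚ) + 2 * ⌊Δ⌋₊ * ideg 𝔮 2 → ⌊c₁ * Δ⌋₊ + 1 < ideg 𝔭 1 → ¬ (Module.finrank ℚ ↥(homogeneousSubmodule (Fin (3 + 1)) ℚ ⌊c₁ * Δ⌋₊) = Module.finrank ℚ ↥(homogeneousSubmodule (Fin (3 + 1)) ℚ ⌊c₁ * Δ⌋₊ ⊓ 𝔭.restrictScalars ℚ) + ideg 𝔭 1) → homogeneousSubmodule (Fin (3 + 1)) ℚ ⌊C₄ * Δ⌋₊ ⊓ 𝔭.restrictScalars ℚ ≤ 𝔮'.restrictScalars ℚ → ∃ (K : Type) (_ : Field K) (_ : NumberField K) (β : Fin 3 → K) (σ : K →+* ℂ), (Module.finrank ℚ K : ℝ) ≤ (c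 * Δ) ^ 3 ∧ Height.logHeight (Fin.cons (1 : K) β : Fin (3 + 1) → K) ≤ c * Y * Δ ^ 2 ∧ ‖(fun j => σ (β j)) - ω‖ ≤ Real.exp (-((Δ * Height.logHeight (Fin.cons (1 : K) β : Fin (3 + 1) → K) + Y * Module.finrank ℚ K) / c))) → (∀ t : ℕ, 4 ≤ t → PointAPAbsAt t) → ApproximationProperty := by
  intro hfarEnv h4
  exact approximationProperty_of_pointAP_three_le (pointAP_three_le_of_farEnv hfarEnv h4)

end

end Summit.Schanuel.Schanuel.Cruxes.ApproximationProperty.OrbitInterpolationDeterminant
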